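import Summits.CriticalPhenomena.PercolationContinuityZ3.Theses.PercQuarantineIslands
import Summits.CriticalPhenomena.PercolationContinuityZ3.Theorems.PercNearOneGluingNoHeavyLowerTailCSHTheoremOne
import Literature.Probability.Percolation.KestenTheorem
import Literature.Probability.Percolation.SharpnessDCTProofs
import Literature.Probability.Percolation.ConnectivityProofs
import HarnessLib

/-!
# `PercQuarantineIslands.DensityHalf` (stmt-CriticalPhenomena-7075) — SETTLED after continuity

Item `stmt-CriticalPhenomena-7075` of route `CriticalPhenomena/PercQuarantineIslands` (support): for every `p` and `n`: `P_p(#{x ∈ Λ_n : x ↔ ∂ⁱⁿΛ_{2n} inside Λ_{2n}} ≥ θ(p)|Λ_n|/2) ≥ θ(p)/2`.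

No ergodic theorem: every percolating `x ∈ Λ_n` is joined inside `Λ_{2n}` to `∂ⁱⁿΛ_{2n}` (first-exit lemma), so the count `V ≤ |Λ_n|` has `E V ≥ θ|Λ_n|`; the reverse Markov inequality `E V ≤ |Λ_n| P(V ≥ a) + a` with `a = θ|Λ_n|/2` gives the claim.  p205010 is NOT used.

builds on p205010 (kernel theorem, internal audit signed; external expert review pending) — USED (`CSH.percolationContinuityZ3_holds`).  RSW3 lane, lead gen 28 (prover-prim-rsw3-lead-g28-0):
'after continuity — the ledger harvest'.
References: G. Kozma, N. Nitzan (2024), Thm. 6 / Conj. 3 [KozmaNitzan2024]; G. Grimmett, *Percolation* (1999), §8 [GrimmettPercolation1999].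
-/

noncomputable section

namespace Summit.CriticalPhenomena.PercolationContinuityZ3.Theorems

namespace PercQuarantineIslandsDensityHalf

open MeasureTheory Literature.Probability.Percolation Literature.Probability.LatticeModels
open DCT16

/-- **`PercQuarantineIslands.DensityHalf` (stmt-CriticalPhenomena-7075), settled.**  first-exit lemma + `E V ≥ θ|Λ_n|`, `V ≤ |Λ_n|` + reverse Markov.
[cite: KozmaNitzan2024, Thm. 6 with Conj. 3 (p. 15)] -/
theorem densityHalf_proof : Summit.CriticalPhenomena.PercolationContinuityZ3.Theses.PercQuarantineIslands.DensityHalf := by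
  classical
  intro p n
  set μ := bondPercolation (zdGraph 3) p with hμ
  set θ : ℝ := theta (zdGraph 3) (0 : Site 3) p with hθ
  -- the boundary-connection events and the count
  set A : Site 3 → Set (BondConfig (Site 3)) := fun x =>
    {ω | ∃ y ∈ innerBoundary (zdGraph 3) (box 3 (2 * n)), ω ∈ openConnIn (↑(box 3 (2 * n)) : Set (Site 3)) x y} with hA
  have hAm : ∀ x, MeasurableSet (A x) := by
    intro x
    have : A x = ⋃ y ∈ innerBoundary (zdGraph 3) (box 3 (2 * n)), openConnIn (↑(box 3 (2 * n)) : Set (Site 3)) x y := by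
      ext ω; simp [hA]
    rw [this]
    exact MeasurableSet.biUnion (Finset.countable_toSet _) fun y _ => measurableSet_openConnIn _ _ _
  set N : ℝ := ((box 3 n).card : ℝ) with hN
  have hNpos : 0 < N := by rw [hN]; exact_mod_cast Finset.card_pos.2 ⟨0, by simp [mem_box]⟩
  set V : BondConfig (Site 3) → ℝ := fun ω => (((box 3 n).filter fun x => ω ∈ A x).card : ℝ) with hV
  have hVsum : ∀ ω, V ω = ∑ x ∈ box 3 n, (A x).indicator (1 : BondConfig (Site 3) → ℝ) ω := by
    intro ω
    rw [hV]
    simp only [Finset.natCast_card_filter, Set.indicator_apply, Pi.one_apply]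
  have hVle : ∀ ω, V ω ≤ N := fun ω => by
    simp only [hV, hN]; exact_mod_cast Finset.card_filter_le _ _
  -- each summand has probability at least θ: a percolating `x ∈ Λ_n` is joined inside `Λ_{2n}` to `∂ⁱⁿΛ_{2n}`
  have hθx : ∀ x ∈ box 3 n, θ ≤ μ.real (A x) := by
    intro x hx
    have h1 : θ = μ.real (percolatesAt x) := by
      rw [hθ, ← theta_zdGraph_eq_theta_zero p x]; rfl
    rw [h1]
    refine real_mono_of_forall_subset_edgeSet (zdGraph 3) p fun ω hω hperc => ?_
    have hinf : (openCluster ω x).Infinite := hperc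
    obtain ⟨y, hyC, hyN⟩ : ∃ y ∈ openCluster ω x, y ∉ box 3 (2 * n) := by
      by_contra h
      push Not at h
      exact hinf ((box 3 (2 * n)).finite_toSet.subset fun y hy => Finset.mem_coe.2 (h y hy))
    obtain ⟨z, hz, hconn⟩ := exists_mem_innerBoundary_openConnIn hω (box 3 (2 * n)) (box_mono 3 (by omega) hx) hyN hyC
    exact ⟨z, hz, hconn⟩
  -- integrability and the expectation of the count
  have hIntInd : ∀ x, Integrable (fun ω => (A x).indicator (1 : BondConfig (Site 3) → ℝ) ω) μ := fun x =>
    (integrable_const (1 : ℝ)).indicator (hAm x)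
  have hVint : Integrable V μ := by
    have : V = fun ω => ∑ x ∈ box 3 n, (A x).indicator (1 : BondConfig (Site 3) → ℝ) ω := funext hVsum
    rw [this]
    exact integrable_finsetSum _ fun x _ => hIntInd x
  have hEV : ∫ ω, V ω ∂μ = ∑ x ∈ box 3 n, μ.real (A x) := by
    have : V = fun ω => ∑ x ∈ box 3 n, (A x).indicator (1 : BondConfig (Site 3) → ℝ) ω := funext hVsum
    rw [this, integral_finsetSum _ fun x _ => hIntInd x]
    refine Finset.sum_congr rfl fun x _ => ?_
    rw [integral_indicator_one (hAm x)]
  have hEVge : N * θ ≤ ∫ ω, V ω ∂μ := by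
    rw [hEV]
    calc N * θ = ∑ x ∈ box 3 n, θ := by rw [Finset.sum_const, nsmul_eq_mul, hN]
      _ ≤ ∑ x ∈ box 3 n, μ.real (A x) := Finset.sum_le_sum hθx
  -- the target event and the reverse Markov inequality `E V ≤ N P(E) + θN/2`
  set E : Set (BondConfig (Site 3)) := {ω | θ * N / 2 ≤ V ω} with hE
  have hVmeas : Measurable V := by
    have : V = fun ω => ∑ x ∈ box 3 n, (A x).indicator (1 : BondConfig (Site 3) → ℝ) ω := funext hVsum
    rw [this]
    exact Finset.measurable_sum _ fun x _ => measurable_const.indicator (hAm x)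
  have hEm : MeasurableSet E := by
    rw [hE]
    exact measurableSet_le measurable_const hVmeas
  have hθnn : 0 ≤ θ := by rw [hθ]; unfold theta; exact measureReal_nonneg
  have ha : 0 ≤ θ * N / 2 := by positivity
  have hpt : ∀ ω, V ω ≤ N * E.indicator (1 : BondConfig (Site 3) → ℝ) ω + θ * N / 2 := by
    intro ω
    by_cases hω : ω ∈ E
    · rw [Set.indicator_of_mem hω, Pi.one_apply, mul_one]
      linarith [hVle ω]
    · rw [Set.indicator_of_notMem hω, mul_zero, zero_add]
      have : ¬ θ * N / 2 ≤ V ω := hω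
      linarith
  haveI : IsProbabilityMeasure μ := by rw [hμ]; infer_instance
  have hIntE : Integrable (fun ω => E.indicator (1 : BondConfig (Site 3) → ℝ) ω) μ := (integrable_const (1 : ℝ)).indicator hEm
  have hEVle : ∫ ω, V ω ∂μ ≤ N * μ.real E + θ * N / 2 := by
    calc ∫ ω, V ω ∂μ ≤ ∫ ω, (N * E.indicator (1 : BondConfig (Site 3) → ℝ) ω + θ * N / 2) ∂μ :=
          integral_mono hVint ((hIntE.const_mul N).add (integrable_const _)) hpt
      _ = N * μ.real E + θ * N / 2 := by
          rw [integral_add (hIntE.const_mul N) (integrable_const _), integral_const_mul, integral_indicator_one hEm,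
            integral_const, smul_eq_mul, probReal_univ, one_mul]
  -- conclusion
  have hfin : θ / 2 ≤ μ.real E := by
    have h := hEVge.trans hEVle
    have h2 : N * (θ / 2) ≤ N * μ.real E := by linarith
    exact le_of_mul_le_mul_left h2 hNpos
  exact hfin

end PercQuarantineIslandsDensityHalf

end Summit.CriticalPhenomena.PercolationContinuityZ3.Theorems

end
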